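/-
Origin: expansion seat `prover-pub-hodgecm-mc-binder-2-g13-0`, handover #64 2026-08-20T07:09Z md5 5bf0ea80a560 (192 l.; 9 s; imports #44 `VLetterIota`, #20 `InvariantSlot`; (J-dense)(iv-b) Σ₁₂ PLACE WITH `V` READ NEGATIVE = the #20-twin: `vcToDPIdxNeg eA r₀ s₀ : VCVar n → DPIdx` (`inl a ↦ (eA a, r₀) ∈ Q×R`, `inr a ↦ (eA a, s₀) ∈ Q×S`; `_injective`, `_surjective [IsEmpty P'] [Unique R'] [Unique S']`), `slotPairingNeg r₀ s₀ = Σ_q X_{(q,s₀)} X_{(q,r₀)}` (`rename_vcToDPIdxNeg_pairing(_pow)`, `slotPairingNeg_eq_rename_P` = #27 `rename_mixedToDPIdxNeg_P`), DICTIONARY **`linSubst_star_dualPairι_kV_rename_vcToDPIdxNeg`**: `linSubst (dualPairι ((a,b),(1,1)))⋆ (rename j F) = rename j (linSubst (vcBlock (vcMatrix eA b)) F)`, `linSubst_star_dualPairι_kV_slotPairingNeg_pow`, `…_kV_of_mem_span_neg`, `mem_span_slotPairingNeg_pow_of_kV_invariant [NeZero n]`, **`kV_invariant_iff_mem_span_slotPairingNeg_pow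 [IsEmpty P'] [Nonempty Q'] [Unique R'] [Unique S']`**: `(∀ b ∈ U(Q'), linSubst (dualPairι ((1,b),(1,1)))⋆ G = G) ↔ G ∈ span {slotPairingNeg^k}` (tree FFT `isVCUnitaryInvariant_iff`); NAME LIST `HodgeCM.Model.HypCensus.kV_invariant_iff_mem_span_slotPairingNeg_pow` · `….linSubst_star_dualPairι_kV_rename_vcToDPIdxNeg` · `….vcToDPIdxNeg`) (`HOME/mc/pub-hodgecm-mc-binder-2/g13/pkg/HodgeCM/Model/HypCensus/DenseSlotSigmaNeg.lean`, md5 5bf0ea80a560, 192 lines);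
landed by the second packager p2 gen 4 (p2-g4) in gate run 44 as `HodgeCM/Model/HypCensus/DenseSlotSigmaNeg.lean` (verbatim).
-/
/-
Copyright (c) 2026. All rights reserved.
Released under Apache 2.0 license as described in the file LICENSE.
-/
import Summits.HodgeConjecture.HodgeCM.Model.HypCensus.VLetterIota
import Summits.HodgeConjecture.HodgeCM.Model.HypCensus.InvariantSlot

/-!
# (J-dense), step (iv-b) at a `Σ₁₂` place with `V` read NEGATIVE: the `K_V`-invariant Fock polynomials are `ℂ[P]`

Binder-2 lineage, rows 18/19 (`hyp12`/`hyp34`), field `dense` of `HypCoreW`.  The #20-twin (`InvariantSlot`: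
`kV_invariant_iff_mem_span_slotPairing_pow`, `V` read positive) for the negative reading of a definite `V_b`: `P' = ∅`, `Q' ≃ Fin n`,
`W_b ≅ U(1,1)` (`R' = {r₀}`, `S' = {s₀}`).  Konno–Konno's `K_V = U(Q')` acts on the slot variables `X_{(q,r)}` (mixed block `Q × R`) by
`conj b` and on `X_{(q,s)}` (same-sign block `Q × S`) by `b` (#44 `linSubst_star_dualPairι_X_QR_general` / `_X_QS_general`) — the
tree's vector–covector substitution `vcBlock` read through

* `vcToDPIdxNeg eA r₀ s₀ : VCVar n → DPIdx P' Q' R' S'`, `inl a ↦ (eA a, r₀) ∈ Q × R`, `inr a ↦ (eA a, s₀) ∈ Q × S`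
  (injective; surjective when `P' = ∅`, `R'`, `S'` singletons); `slotPairingNeg r₀ s₀ = Σ_q X_{(q,s₀)} X_{(q,r₀)}`
  (`= rename (mixedToDPIdxNeg P' eA r₀ s₀) P`, #27 `rename_mixedToDPIdxNeg_P`);
* **`linSubst_star_dualPairι_kV_rename_vcToDPIdxNeg`**: `linSubst (dualPairι ((a,b),(1,1)))⋆ (rename j F) = rename j (linSubst (vcBlock (vcMatrix eA b)) F)`;
* **`kV_invariant_iff_mem_span_slotPairingNeg_pow`** (`[IsEmpty P'] [Nonempty Q'] [Unique R'] [Unique S']`):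
  `(∀ b ∈ U(Q'), linSubst (dualPairι ((1,b),(1,1)))⋆ G = G) ↔ G ∈ span {slotPairingNeg^k}` (tree FFT `isVCUnitaryInvariant_iff`).

[GoodmanWallachGTM255, Thm 5.2.1; Folland1989, Prop. (4.39)]  Nothing here is a claim of PerL/QW8.
-/

noncomputable section

open MvPolynomial Complex
open scoped BigOperators ComplexConjugate
open Literature.Analysis.SegalBargmann
open Literature.RepresentationTheory.ClassicalInvariants

namespace HodgeCM.Model.HypCensus

section SlotNeg

variable {P' Q' R' S' : Type} [Fintype P'] [DecidableEq P'] [Fintype Q'] [DecidableEq Q'] [Fintype R'] [DecidableEq R']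
  [Fintype S'] [DecidableEq S'] {n : ℕ} (eA : Fin n ≃ Q') (r₀ : R') (s₀ : S')

/-! ## §1 The variables and the pairing of the slot, negative reading -/

/-- the tree's vector–covector variables into the negatively read slot: `inl a ↦ (eA a, r₀)` (mixed block `Q' × R'`, substituted by
`conj b`), `inr a ↦ (eA a, s₀)` (same-sign block `Q' × S'`, substituted by `b`). -/
def vcToDPIdxNeg : VCVar n → DPIdx P' Q' R' S' :=
  Sum.elim (fun a => Sum.inr (Sum.inr (eA a, r₀))) (fun a => Sum.inl (Sum.inr (eA a, s₀)))

omit [Fintype P'] [DecidableEq P'] [Fintype Q'] [DecidableEq Q'] [Fintype R'] [DecidableEq R'] [Fintype S'] [DecidableEq S'] in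
/-- (Ported verbatim from the HodgeCMPerL package; no docstring in the source.) -/
@[simp] theorem vcToDPIdxNeg_inl (a : Fin n) : vcToDPIdxNeg (P' := P') eA r₀ s₀ (Sum.inl a) = Sum.inr (Sum.inr (eA a, r₀)) := rfl

omit [Fintype P'] [DecidableEq P'] [Fintype Q'] [DecidableEq Q'] [Fintype R'] [DecidableEq R'] [Fintype S'] [DecidableEq S'] in
/-- (Ported verbatim from the HodgeCMPerL package; no docstring in the source.) -/
@[simp] theorem vcToDPIdxNeg_inr (a : Fin n) : vcToDPIdxNeg (P' := P') eA r₀ s₀ (Sum.inr a) = Sum.inl (Sum.inr (eA a, s₀)) := rfl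

omit [Fintype P'] [DecidableEq P'] [Fintype Q'] [DecidableEq Q'] [Fintype R'] [DecidableEq R'] [Fintype S'] [DecidableEq S'] in
/-- `vcToDPIdxNeg` is injective. [folklore] -/
theorem vcToDPIdxNeg_injective : Function.Injective (vcToDPIdxNeg (P' := P') eA r₀ s₀) := by
  rintro (a | a) (b | b) h
  · simp only [vcToDPIdxNeg_inl, Sum.inr.injEq, Prod.mk.injEq, eA.injective.eq_iff, and_true] at h
    rw [h]
  · simp only [vcToDPIdxNeg_inl, vcToDPIdxNeg_inr, reduceCtorEq] at h
  · simp only [vcToDPIdxNeg_inl, vcToDPIdxNeg_inr, reduceCtorEq] at h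
  · simp only [vcToDPIdxNeg_inr, Sum.inl.injEq, Sum.inr.injEq, Prod.mk.injEq, eA.injective.eq_iff, and_true] at h
    rw [h]

omit [Fintype P'] [DecidableEq P'] [Fintype Q'] [DecidableEq Q'] [Fintype R'] [DecidableEq R'] [Fintype S'] [DecidableEq S'] in
/-- in the negatively read census slot (`P' = ∅`, `R' = {r₀}`, `S' = {s₀}`) every variable is a `vcToDPIdxNeg`-image. [folklore] -/
theorem vcToDPIdxNeg_surjective [IsEmpty P'] [Unique R'] [Unique S'] : Function.Surjective (vcToDPIdxNeg (P' := P') eA r₀ s₀) := by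
  rintro ((⟨p, _⟩ | ⟨q, s⟩) | (⟨p, _⟩ | ⟨q, r⟩))
  · exact isEmptyElim p
  · exact ⟨Sum.inr (eA.symm q), by rw [vcToDPIdxNeg_inr, eA.apply_symm_apply, Unique.eq_default s, Unique.eq_default s₀]⟩
  · exact isEmptyElim p
  · exact ⟨Sum.inl (eA.symm q), by rw [vcToDPIdxNeg_inl, eA.apply_symm_apply, Unique.eq_default r, Unique.eq_default r₀]⟩

/-- **the pairing of the negatively read slot** `Σ_q X_{(q,s₀)} X_{(q,r₀)}`. -/
def slotPairingNeg : MvPolynomial (DPIdx P' Q' R' S') ℂ :=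
  ∑ q : Q', X (Sum.inl (Sum.inr (q, s₀))) * X (Sum.inr (Sum.inr (q, r₀)))

omit [DecidableEq Q'] [Fintype P'] [DecidableEq P'] [Fintype R'] [DecidableEq R'] [Fintype S'] [DecidableEq S'] in
/-- the tree's pairing `Σ_a z_a w_a` renames to the slot pairing. [folklore] -/
theorem rename_vcToDPIdxNeg_pairing : rename (vcToDPIdxNeg (P' := P') eA r₀ s₀) (pairing ℂ n) = slotPairingNeg (P' := P') r₀ s₀ := by
  simp only [pairing, slotPairingNeg, map_sum, map_mul, rename_X, vcToDPIdxNeg_inl, vcToDPIdxNeg_inr]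
  rw [← eA.sum_comp]
  exact Finset.sum_congr rfl fun a _ => mul_comm _ _

omit [DecidableEq Q'] [Fintype P'] [DecidableEq P'] [Fintype R'] [DecidableEq R'] [Fintype S'] [DecidableEq S'] in
/-- … and so do its powers. [folklore] -/
theorem rename_vcToDPIdxNeg_pairing_pow (k : ℕ) :
    rename (vcToDPIdxNeg (P' := P') eA r₀ s₀) (pairing ℂ n ^ k) = slotPairingNeg (P' := P') r₀ s₀ ^ k := by
  rw [map_pow, rename_vcToDPIdxNeg_pairing]

omit [DecidableEq Q'] [Fintype P'] [DecidableEq P'] [Fintype R'] [DecidableEq R'] [Fintype S'] [DecidableEq S'] in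
/-- the slot pairing is pv12's `P` read through `mixedToDPIdxNeg` (#27). -/
theorem slotPairingNeg_eq_rename_P (eA₃ : Fin 3 ≃ Q') :
    slotPairingNeg (P' := P') r₀ s₀ = rename (mixedToDPIdxNeg P' eA₃ r₀ s₀) HodgeCM.PerL34.Fock.P := by
  rw [rename_mixedToDPIdxNeg_P]; rfl

/-! ## §2 The dictionary with the tree's vector–covector substitution -/

/-- **THE DICTIONARY (negative reading)**: the `K_V`-letter on the renamed tree polynomial IS the tree's vector–covector substitution by
`vcMatrix eA b` (`z ↦ ḡz` on `Q × R`, `w ↦ gw` on `Q × S`, `g = (b∘eA)ᵀ`). [Folland1989, Prop. (4.39); GoodmanWallachGTM255, §5.2.1] -/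
theorem linSubst_star_dualPairι_kV_rename_vcToDPIdxNeg (a : Matrix.unitaryGroup P' ℂ) (b : Matrix.unitaryGroup Q' ℂ)
    (F : MvPolynomial (VCVar n) ℂ) :
    linSubst (star ((dualPairι (((a, b), (1, 1)) : DPK P' Q' R' S') : Matrix.unitaryGroup (DPIdx P' Q' R' S') ℂ) :
        Matrix (DPIdx P' Q' R' S') (DPIdx P' Q' R' S') ℂ)) (rename (vcToDPIdxNeg eA r₀ s₀) F) =
      rename (vcToDPIdxNeg eA r₀ s₀) (linSubst (vcBlock (vcMatrix eA (b : Matrix Q' Q' ℂ))) F) := by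
  suffices h : (linSubst (star ((dualPairι (((a, b), (1, 1)) : DPK P' Q' R' S') : Matrix.unitaryGroup (DPIdx P' Q' R' S') ℂ) :
        Matrix (DPIdx P' Q' R' S') (DPIdx P' Q' R' S') ℂ))).comp (rename (vcToDPIdxNeg eA r₀ s₀)) =
      (rename (vcToDPIdxNeg eA r₀ s₀)).comp (linSubst (vcBlock (vcMatrix eA (b : Matrix Q' Q' ℂ)))) from
    DFunLike.congr_fun h F
  refine MvPolynomial.algHom_ext fun v => ?_
  rcases v with c | c
  · rw [AlgHom.comp_apply, AlgHom.comp_apply, rename_X, vcToDPIdxNeg_inl, linSubst_star_dualPairι_X_QR_general,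
      linSubst_vcBlock_X_inl, map_sum]
    simp only [map_mul, rename_C, rename_X, vcToDPIdxNeg_inl, vcMatrix, Complex.star_def, OneMemClass.coe_one, Matrix.one_apply,
      apply_ite (starRingEnd ℂ), map_one, map_zero, mul_ite, mul_one, mul_zero, apply_ite C, ite_mul, zero_mul,
      Finset.sum_ite_eq', Finset.mem_univ, if_true]
    exact (eA.sum_comp fun q' => C (conj ((b : Matrix Q' Q' ℂ) q' (eA c))) * X (Sum.inr (Sum.inr (q', r₀)))).symm
  · rw [AlgHom.comp_apply, AlgHom.comp_apply, rename_X, vcToDPIdxNeg_inr, linSubst_star_dualPairι_X_QS_general,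
      linSubst_vcBlock_X_inr, map_sum]
    simp only [map_mul, rename_C, rename_X, vcToDPIdxNeg_inr, vcMatrix, OneMemClass.coe_one, Matrix.one_apply, mul_ite, mul_one,
      mul_zero, apply_ite C, map_zero, ite_mul, zero_mul, Finset.sum_ite_eq', Finset.mem_univ, if_true]
    exact (eA.sum_comp fun q' => C ((b : Matrix Q' Q' ℂ) q' (eA c)) * X (Sum.inl (Sum.inr (q', s₀)))).symm

/-! ## §3 The invariant Fock polynomials of the negatively read slot are `ℂ[P]` -/

/-- `ℂ[P_slot]` is `K_V`-invariant (negative reading). [folklore] -/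
theorem linSubst_star_dualPairι_kV_slotPairingNeg_pow (a : Matrix.unitaryGroup P' ℂ) (b : Matrix.unitaryGroup Q' ℂ) (k : ℕ) :
    linSubst (star ((dualPairι (((a, b), (1, 1)) : DPK P' Q' R' S') : Matrix.unitaryGroup (DPIdx P' Q' R' S') ℂ) :
        Matrix (DPIdx P' Q' R' S') (DPIdx P' Q' R' S') ℂ)) (slotPairingNeg r₀ s₀ ^ k) = slotPairingNeg r₀ s₀ ^ k := by
  have h := isVCUnitaryInvariant_pairing_pow (n := Fintype.card Q') k
    ⟨vcMatrix (Fintype.equivFin Q').symm (b : Matrix Q' Q' ℂ), vcMatrix_mem_unitaryGroup (Fintype.equivFin Q').symm b⟩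
  rw [Subtype.coe_mk] at h
  rw [← rename_vcToDPIdxNeg_pairing_pow (Fintype.equivFin Q').symm, linSubst_star_dualPairι_kV_rename_vcToDPIdxNeg, h]

/-- … hence so is every element of `span {P_slot^k}`. [folklore] -/
theorem linSubst_star_dualPairι_kV_of_mem_span_neg (a : Matrix.unitaryGroup P' ℂ) (b : Matrix.unitaryGroup Q' ℂ)
    {G : MvPolynomial (DPIdx P' Q' R' S') ℂ} (hG : G ∈ Submodule.span ℂ (Set.range fun k : ℕ => slotPairingNeg (P' := P') r₀ s₀ ^ k)) :
    linSubst (star ((dualPairι (((a, b), (1, 1)) : DPK P' Q' R' S') : Matrix.unitaryGroup (DPIdx P' Q' R' S') ℂ) :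
        Matrix (DPIdx P' Q' R' S') (DPIdx P' Q' R' S') ℂ)) G = G := by
  induction hG using Submodule.span_induction with
  | mem x hx =>
    obtain ⟨k, rfl⟩ := hx
    exact linSubst_star_dualPairι_kV_slotPairingNeg_pow r₀ s₀ a b k
  | zero => exact map_zero _
  | add x y _ _ hx hy => rw [map_add, hx, hy]
  | smul c x _ hx => rw [map_smul, hx]

/-- a `K_V`-invariant Fock polynomial in the image of the slot variables is in `ℂ[P_slot]` (negative reading; transfer of the tree's FFT
`isVCUnitaryInvariant_iff` through the dictionary). [GoodmanWallachGTM255, Thm 5.2.1] -/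
theorem mem_span_slotPairingNeg_pow_of_kV_invariant [NeZero n] (F : MvPolynomial (VCVar n) ℂ)
    (hinv : ∀ b : Matrix.unitaryGroup Q' ℂ,
      linSubst (star ((dualPairι ((((1 : Matrix.unitaryGroup P' ℂ), b), (1, 1)) : DPK P' Q' R' S') :
          Matrix.unitaryGroup (DPIdx P' Q' R' S') ℂ) : Matrix (DPIdx P' Q' R' S') (DPIdx P' Q' R' S') ℂ))
        (rename (vcToDPIdxNeg eA r₀ s₀) F) = rename (vcToDPIdxNeg eA r₀ s₀) F) :
    rename (vcToDPIdxNeg eA r₀ s₀) F ∈ Submodule.span ℂ (Set.range fun k : ℕ => slotPairingNeg (P' := P') r₀ s₀ ^ k) := by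
  have hF : IsVCUnitaryInvariant F := fun g => by
    have h := hinv ⟨ofVCMatrix eA (g : Matrix (Fin n) (Fin n) ℂ), ofVCMatrix_mem_unitaryGroup eA g⟩
    rw [linSubst_star_dualPairι_kV_rename_vcToDPIdxNeg, Subtype.coe_mk, vcMatrix_ofVCMatrix] at h
    exact rename_injective _ (vcToDPIdxNeg_injective eA r₀ s₀) h
  have h2 : rename (vcToDPIdxNeg eA r₀ s₀) F ∈
      (Submodule.span ℂ (Set.range fun k : ℕ => pairing ℂ n ^ k)).map (rename (vcToDPIdxNeg (P' := P') eA r₀ s₀)).toLinearMap :=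
    Submodule.mem_map_of_mem ((isVCUnitaryInvariant_iff F).mp hF)
  rw [Submodule.map_span, ← Set.range_comp] at h2
  have hr : ((rename (vcToDPIdxNeg (P' := P') eA r₀ s₀)).toLinearMap ∘ fun k : ℕ => pairing ℂ n ^ k) =
      fun k : ℕ => slotPairingNeg (P' := P') r₀ s₀ ^ k :=
    funext fun k => rename_vcToDPIdxNeg_pairing_pow eA r₀ s₀ k
  rw [hr] at h2
  exact h2

/-- **THE `K_V`-INVARIANT FOCK POLYNOMIALS OF THE NEGATIVELY READ CENSUS SLOT ARE `ℂ[P]`** (`P' = ∅`, `R' = {r₀}`, `S' = {s₀}`, `Q'`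
nonempty): `(∀ b ∈ U(Q'), linSubst (dualPairι ((1,b),(1,1)))⋆ G = G) ↔ G ∈ span {P_slot^k}`.
[GoodmanWallachGTM255, Thm 5.2.1; Folland1989, Prop. (4.39)] -/
theorem kV_invariant_iff_mem_span_slotPairingNeg_pow [IsEmpty P'] [Nonempty Q'] [Unique R'] [Unique S']
    (G : MvPolynomial (DPIdx P' Q' R' S') ℂ) :
    (∀ b : Matrix.unitaryGroup Q' ℂ,
      linSubst (star ((dualPairι ((((1 : Matrix.unitaryGroup P' ℂ), b), (1, 1)) : DPK P' Q' R' S') :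
          Matrix.unitaryGroup (DPIdx P' Q' R' S') ℂ) : Matrix (DPIdx P' Q' R' S') (DPIdx P' Q' R' S') ℂ)) G = G) ↔
      G ∈ Submodule.span ℂ (Set.range fun k : ℕ => slotPairingNeg (P' := P') r₀ s₀ ^ k) := by
  haveI : NeZero (Fintype.card Q') := ⟨Fintype.card_ne_zero⟩
  constructor
  · intro h
    obtain ⟨F, rfl⟩ := exists_rename_eq_of_vars_subset_range G (vcToDPIdxNeg (P' := P') (Fintype.equivFin Q').symm r₀ s₀)
      (vcToDPIdxNeg_injective (Fintype.equivFin Q').symm r₀ s₀) fun v _ => vcToDPIdxNeg_surjective (Fintype.equivFin Q').symm r₀ s₀ v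
    exact mem_span_slotPairingNeg_pow_of_kV_invariant (Fintype.equivFin Q').symm r₀ s₀ F h
  · intro hG b
    exact linSubst_star_dualPairι_kV_of_mem_span_neg r₀ s₀ 1 b hG

end SlotNeg

end HodgeCM.Model.HypCensus

end
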